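import Mathlib.Topology.Homotopy.Lifting
import Mathlib.Analysis.Convex.Contractible
import Mathlib.Topology.Algebra.Module.LocallyConvex
import Mathlib.Analysis.Complex.Polynomial.Basic
import Literature.NumberTheory.Transcendental.HypersurfaceCover
import HarnessLib

/-!
# Holomorphic root sections of an unramified monic polynomial over a ball

Analytic input for the proof of `Literature.NumberTheory.Transcendental.BrownawellMasser2017_dominantProjection`
(D'Aquino–Fornasiero–Terzo, *Generic solutions of equations with iterated exponentials*,
Trans. AMS 370 (2018), §2: "Given polynomials `pᵢ(x̄, u)` … there exist a nonempty cone `U` and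
algebraic functions `fᵢ : U → ℂ` such that `pᵢ(x̄, fᵢ(x̄)) = 0` on all `U`", and the proof of
Cor. 2.9 / Lemma 2.10 where the branches are chosen on one sheet of the variety):

* `Literature.NumberTheory.Transcendental.ExpDominant.exists_rootSection` — let `F ∈ ℂ[z₁, …, z_r][T]` be monic of positive degree
  and suppose `F(z, ·)` is separable for every `z` in the closed ball `B̄(c, R)`. Then there is a
  function `τ`, holomorphic on the open ball `B(c, R)`, with `F(z, τ(z)) = 0` there.

Proof. The zero set `E = {(z, t) | z ∈ B̄(c, R), F(z, t) = 0}` is compact (Cauchy's bound for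
the roots, `HypersurfaceCover.norm_le_rootBound`), and the projection `E → ℂʳ` restricts to a
homeomorphism near every point over the ball (holomorphic implicit function theorem,
`HypersurfaceCover.exists_rootFunction`), hence is a covering map over `B(c, R)` (Mathlib
`IsCoveringMapOn.of_isLocalHomeomorphOn`). The ball is convex, so simply connected and locally
path connected, and the inclusion `B(c, R) ↪ ℂʳ` lifts to a continuous section (Mathlib
`IsCoveringMapOn.existsUnique_continuousMap_lifts`); a continuous root function is holomorphic by
the uniqueness clause of the implicit function theorem (the monodromy theorem for the unramified
cover `F = 0 → ℂʳ`, e.g. Shafarevich, *Basic Algebraic Geometry 2*, VII §2.3).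

## References

* P. D'Aquino, A. Fornasiero, G. Terzo, Trans. Amer. Math. Soc. 370 (2018), §2.1.
* I. R. Shafarevich, *Basic Algebraic Geometry 2*, Springer 1994, Book 3, Ch. VII §2.3.
-/

noncomputable section

open Metric Set Filter Topology

namespace Literature.NumberTheory.Transcendental.ExpDominant

open HypersurfaceCover

/-- **Holomorphic root sections over a ball** (monodromy for the unramified cover
`{F = 0} → ℂʳ`; the "algebraic functions on a cone" of D'Aquino–Fornasiero–Terzo 2018, §2.1).
If `F ∈ ℂ[z₁, …, z_r][T]` is monic of positive degree and `F(z, ·)` is separable for all `z` in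
the closed ball `B̄(c, R)`, `R > 0`, then there is `τ : ℂʳ → ℂ` holomorphic on the open ball
`B(c, R)` with `F(z, τ(z)) = 0` for all `z ∈ B(c, R)`.
[cite: DaquinoFornasieroTerzo2017, §2.1 (before Cor. 2.9)] -/
theorem exists_rootSection {r : ℕ} {F : Polynomial (MvPolynomial (Fin r) ℂ)} (hF : F.Monic)
    (hdeg : 0 < F.natDegree) {c : Fin r → ℂ} {R : ℝ} (hR : 0 < R)
    (hsep : ∀ z ∈ closedBall c R, (spec F z).Separable) :
    ∃ τ : (Fin r → ℂ) → ℂ, DifferentiableOn ℂ τ (ball c R) ∧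
      ∀ z ∈ ball c R, (spec F z).eval (τ z) = 0 := by
  classical
  -- the total space: zeros of `F` over the closed ball, a compact set
  set S : Set ((Fin r → ℂ) × ℂ) := {p | p.1 ∈ closedBall c R ∧ (spec F p.1).eval p.2 = 0}
    with hS
  have hSclosed : IsClosed S := by
    have h1 : IsClosed {p : (Fin r → ℂ) × ℂ | p.1 ∈ closedBall c R} :=
      isClosed_closedBall.preimage continuous_fst
    have h2 : IsClosed {p : (Fin r → ℂ) × ℂ | (spec F p.1).eval p.2 = 0} :=
      isClosed_singleton.preimage (contDiff_eval_spec F (n := 0)).continuous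
    exact h1.inter h2
  obtain ⟨C, hC1, D, hCD⟩ := exists_rootBound_le_pow F
  set B : ℝ := C * (1 + (‖c‖ + R)) ^ D with hB
  have hSbdd : Bornology.IsBounded S := by
    refine ((isBounded_closedBall (x := c) (r := R)).prod
      (isBounded_closedBall (x := (0 : ℂ)) (r := B))).subset ?_
    rintro ⟨z, t⟩ ⟨hz, hzt⟩
    refine mk_mem_prod hz ?_
    rw [mem_closedBall, dist_zero_right]
    have ht : t ∈ fiber F z := (mem_fiber hF).2 hzt
    have h1 := norm_le_rootBound hF ht
    have h2 := hCD z
    have hz' : ‖z‖ ≤ ‖c‖ + R := by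
      rw [mem_closedBall, dist_eq_norm] at hz
      calc ‖z‖ = ‖(z - c) + c‖ := by rw [sub_add_cancel]
        _ ≤ ‖z - c‖ + ‖c‖ := norm_add_le _ _
        _ ≤ ‖c‖ + R := by linarith
    have hC0 : 0 ≤ C := by linarith
    calc ‖t‖ ≤ rootBound F z := h1
      _ ≤ C * (1 + ‖z‖) ^ D := by linarith [one_le_rootBound F z]
      _ ≤ B := by rw [hB]; gcongr
  have hScpt : IsCompact S := isCompact_of_isClosed_isBounded hSclosed hSbdd
  haveI : CompactSpace S := isCompact_iff_compactSpace.mp hScpt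
  -- the projection
  set π : S → (Fin r → ℂ) := fun e => e.1.1 with hπ
  have hπc : Continuous π := continuous_fst.comp continuous_subtype_val
  -- `π` is a local homeomorphism near every point over the open ball
  have hloc : IsLocalHomeomorphOn π (π ⁻¹' ball c R) := by
    refine IsLocalHomeomorphOn.mk π _ fun e he => ?_
    obtain ⟨⟨z₀, t₀⟩, hz₀R, hzt₀⟩ := e
    have hz₀ : z₀ ∈ ball c R := he
    have hδ := derivative_eval_ne_zero (hsep z₀ hz₀R) hzt₀
    obtain ⟨ρ, hρ0, hρF, hρd, hρu⟩ := exists_rootFunction F hzt₀ hδ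
    obtain ⟨U₁, hU₁, V, hV, hUV⟩ := mem_nhds_prod_iff.mp hρu
    obtain ⟨V', hV'V, hV'open, ht₀V'⟩ := _root_.mem_nhds_iff.mp hV
    have hρcont : ContinuousAt ρ z₀ := hρd.self_of_nhds.continuousAt
    have hρV' : ∀ᶠ z in 𝓝 z₀, ρ z ∈ V' := by
      refine hρcont.preimage_mem_nhds (hV'open.mem_nhds ?_)
      rw [hρ0]; exact ht₀V'
    have hall : ∀ᶠ z in 𝓝 z₀, z ∈ ball c R ∧ z ∈ U₁ ∧ (spec F z).eval (ρ z) = 0 ∧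
        DifferentiableAt ℂ ρ z ∧ ρ z ∈ V' := by
      filter_upwards [isOpen_ball.mem_nhds hz₀, hU₁, hρF, hρd, hρV'] with z h1 h2 h3 h4 h5
      exact ⟨h1, h2, h3, h4, h5⟩
    obtain ⟨U, hUsub, hUopen, hz₀U⟩ := _root_.mem_nhds_iff.mp hall
    have hUprop : ∀ z ∈ U, z ∈ ball c R ∧ z ∈ U₁ ∧ (spec F z).eval (ρ z) = 0 ∧
        DifferentiableAt ℂ ρ z ∧ ρ z ∈ V' := fun z hz => hUsub hz
    let e₀ : S := ⟨(z₀, t₀), hz₀R, hzt₀⟩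
    let inv : (Fin r → ℂ) → S := fun z =>
      if hz : z ∈ U then ⟨(z, ρ z), ball_subset_closedBall (hUprop z hz).1, (hUprop z hz).2.2.1⟩
      else e₀
    have hinv : ∀ z ∈ U, (inv z : (Fin r → ℂ) × ℂ) = (z, ρ z) := fun z hz => by
      simp only [inv, dif_pos hz]
    let Ψ : OpenPartialHomeomorph S (Fin r → ℂ) :=
    { toFun := π
      invFun := inv
      source := {e' : S | e'.1.1 ∈ U ∧ e'.1.2 ∈ V'}
      target := U
      map_source' := fun e' he' => he'.1
      map_target' := fun z hz => by
        refine ⟨?_, ?_⟩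
        · rw [hinv z hz]; exact hz
        · rw [hinv z hz]; exact (hUprop z hz).2.2.2.2
      left_inv' := fun e' he' => by
        obtain ⟨⟨z, t⟩, hzR, hzt⟩ := e'
        obtain ⟨hzU, htV'⟩ := he'
        have hzU' : z ∈ U := hzU
        have hρzt : ρ z = t := hUV (mk_mem_prod (hUprop z hzU').2.1 (hV'V htV')) hzt
        apply Subtype.ext
        change (inv z).1 = (z, t)
        rw [hinv z hzU', hρzt]
      right_inv' := fun z hz => by
        change (inv z).1.1 = z
        rw [hinv z hz]
      open_source := by
        have : {e' : S | e'.1.1 ∈ U ∧ e'.1.2 ∈ V'} = Subtype.val ⁻¹' (U ×ˢ V') := by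
          ext e'; simp [mem_prod]
        rw [this]
        exact (hUopen.prod hV'open).preimage continuous_subtype_val
      open_target := hUopen
      continuousOn_toFun := hπc.continuousOn
      continuousOn_invFun := by
        rw [Topology.IsInducing.subtypeVal.continuousOn_iff]
        have heq : EqOn (fun z => (z, ρ z)) (Subtype.val ∘ inv) U := fun z hz => by
          simp only [Function.comp_apply, hinv z hz]
        refine ContinuousOn.congr ?_ (fun z hz => (heq hz).symm)
        exact continuousOn_id.prodMk fun z hz =>
          (hUprop z hz).2.2.2.1.continuousAt.continuousWithinAt }
    exact ⟨Ψ, ⟨hz₀U, ht₀V'⟩, fun e' _ => rfl⟩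
  have hcov : IsCoveringMapOn π (ball c R) := IsCoveringMapOn.of_isLocalHomeomorphOn hπc hloc
  -- lift the inclusion of the (simply connected, locally path connected) ball
  haveI : SimplyConnectedSpace (ball c R) := by
    haveI := (convex_ball c R).contractibleSpace ⟨c, mem_ball_self hR⟩
    infer_instance
  haveI : LocallyPathConnectedSpace (ball c R) := isOpen_ball.locallyPathConnectedSpace
  obtain ⟨t₀, ht₀⟩ : ∃ t, (spec F c).IsRoot t := Complex.exists_root (by
    rw [Polynomial.degree_eq_natDegree (spec_ne_zero hF c), natDegree_spec hF]
    exact_mod_cast hdeg)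
  let e₀ : S := ⟨(c, t₀), mem_closedBall_self hR.le, ht₀⟩
  let incl : C(ball c R, Fin r → ℂ) := ⟨Subtype.val, continuous_subtype_val⟩
  obtain ⟨Φ, ⟨-, hΦπ⟩, -⟩ := hcov.existsUnique_continuousMap_lifts incl
    (a₀ := ⟨c, mem_ball_self hR⟩) (e₀ := e₀) rfl (fun a => a.2)
  have hΦ1 : ∀ a : ball c R, (Φ a).1.1 = a := fun a => congr_fun hΦπ a
  -- the section
  let τ : (Fin r → ℂ) → ℂ := fun z => if hz : z ∈ ball c R then (Φ ⟨z, hz⟩).1.2 else 0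
  have hτroot : ∀ z ∈ ball c R, (spec F z).eval (τ z) = 0 := fun z hz => by
    simp only [τ, dif_pos hz]
    have h := (Φ ⟨z, hz⟩).2.2
    rwa [hΦ1] at h
  have hτcont : ContinuousOn τ (ball c R) := by
    rw [continuousOn_iff_continuous_restrict]
    have : (ball c R).restrict τ = fun a => (Φ a).1.2 := by
      funext a
      simp only [restrict_apply, τ, dif_pos a.2]
    rw [this]
    fun_prop
  refine ⟨τ, fun z₁ hz₁ => ?_, hτroot⟩
  -- holomorphy from the uniqueness clause of the implicit function theorem
  have hzt₁ := hτroot z₁ hz₁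
  have hδ := derivative_eval_ne_zero (hsep z₁ (ball_subset_closedBall hz₁)) hzt₁
  obtain ⟨ρ, -, -, hρd, hρu⟩ := exists_rootFunction F hzt₁ hδ
  have hτat : ContinuousAt τ z₁ := hτcont.continuousAt (isOpen_ball.mem_nhds hz₁)
  have hpair : Tendsto (fun z => (z, τ z)) (𝓝 z₁) (𝓝 (z₁, τ z₁)) :=
    (continuousAt_id.prodMk hτat).tendsto
  have hev : ∀ᶠ z in 𝓝 z₁, τ z = ρ z := by
    have h1 := hpair.eventually hρu
    filter_upwards [h1, isOpen_ball.mem_nhds hz₁] with z hz hzb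
    exact (hz (hτroot z hzb)).symm
  exact (hρd.self_of_nhds.congr_of_eventuallyEq hev).differentiableWithinAt

end Literature.NumberTheory.Transcendental.ExpDominant
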